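import Literature.AlgebraicGeometry.Frobenioids.PadicKummerThm24iFrobenioidRelTheta
import Literature.AnabelianGeometry.AbsoluteAnabelian.AbsAnabUnitsTransportInnerTwist
import Literature.AnabelianGeometry.AbsoluteAnabelian.MonoAnalyticNonarchModel
import HarnessLib

/-!
# Frobenioids II, Thm. 2.4: the two representatives of the outer isomorphism `G₁ ⥲ G₂` differ by an INNER twist
# (`isoGOfTheta` of abc-iut-L1-t7 gen 5 vs the `galConjBase`-conjugate `α` of abc-iut-w5-d229's pair)

Mochizuki, *The geometry of Frobenioids II*, Kyushu J. Math. **62** (2008) 401–460, §2, Theorem 2.4 p. 19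
[cite: MochizukiFrdII2008, Thm 2.4 (i) p.19]: "`Ψ_Base : D₁ ⥲ D₂`, hence an outer isomorphism of topological groups `Π₁ ⥲ Π₂` …
that lies over an outer isomorphism of topological groups `G₁ ⥲ G₂`".

PROOF-ONLY scratch for the cell's successor item «T24ii-J2» (recipe step (e) of HOME/abc-iut-L1-t7/HANDOFF.md; seat
abc-iut-L1-t7 gen 7). For the data of abc-iut-L1-t7 gen 5's `PadicFrd.RelGal.isoGOfTheta` (`θ : Π₁ ↠ Π₂` over the `G`'s, `e` the
base identification at `A₁`) and ANY `ψ : Im φ₁ ≃ₜ* Im φ₂` through which `θ` descends (`hψθ : ψ(φ₁ g) = φ₂(θ g)` — the shape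
exported by abc-iut-w5-d229's `exists_pairIso_fbarUnits_levelwise`) and ANY `α : G_{K₁} ≃ₜ* G_{K₂}` that is `ψ` through
`galConjBase` (`hα` — the shape exported by `exists_isAlphaEquivariant_of_compatible`):
`isoGOfTheta σ = δ⁻¹ · α σ · δ` with `δ := galConjBase₂⁻¹ (φ₂ c)`, `c = baseRep` (`isoGOfTheta_eq_innerTwist`), i.e. the
hypothesis `hα'` of abc-iut-L1-t7 gen 7's `AbsAnabUnitsTransportInnerTwist` with `δ⁻¹` in place of `δ`
(`isoGOfTheta_eq_innerTwist'`); hence, by the rigidity of the [AbsAnab] Prop. 1.2.1 (vi)/(vii) units transport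
(`unitsTransport_unique`, abc-iut-L1-t7 gen 7's `IsAlphaEquivariant.eq_innerTwist`), THE units transport for abc-iut-L1-t7's
representative is `δ⁻¹ •` THE one for abc-iut-w5-d229's `α` (`unitsTransport_isoGOfTheta_apply`, for the `p`-adic MLF structures
`PadicAlgCl.subfieldValuativeRel` of the base fields `Kᵢ = ℚ̄_{pᵢ}^{Im Πᵢ}`). Classical bookkeeping; nothing here concerns [IUTchIII].
-/

noncomputable section

namespace Literature.AlgebraicGeometry.Frobenioids

namespace PadicFrd

namespace RelGal

open CategoryTheory Function Field IntermediateField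
open Literature.NumberTheory.GaloisRepresentations
open Literature.AnabelianGeometry.SemiGraphs QuasiTemperoid
open Literature.AnabelianGeometry.AbsoluteAnabelian

variable {p₁ p₂ : ℕ} [Fact p₁.Prime] [Fact p₂.Prime]
  {P₁ : Type} [Group P₁] [TopologicalSpace P₁] (φ₁ : P₁ →* GalFbar ℚ_[p₁]) (hφ₁ : IsOpenHom φ₁) {P₁₀ : OpenSubgroup P₁}
  {d₁ : Datum (RelCosetCat P₁₀) p₁}
  {P₂ : Type} [Group P₂] [TopologicalSpace P₂] (φ₂ : P₂ →* GalFbar ℚ_[p₂]) (hφ₂ : IsOpenHom φ₂) {P₂₀ : OpenSubgroup P₂}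
  {d₂ : Datum (RelCosetCat P₂₀) p₂}
  (F : d₁.frobenioid ⥤ d₂.frobenioid) {A₁ : d₁.frobenioid}
  (θ : P₁ →* P₂) (hθc : Continuous θ) (hθo : IsOpenMap θ) (hθs : Surjective θ)
  (hkerθ : ∀ x : P₁, φ₁ x = 1 ↔ φ₂ (θ x) = 1)
  (e : (CosetCat.push θ hθo).obj A₁.base.obj ≅ (F.obj A₁).base.obj)
  (ψ : φ₁.range ≃ₜ* φ₂.range) (hψθ : ∀ g : P₁, (ψ ⟨φ₁ g, ⟨g, rfl⟩⟩ : GalFbar ℚ_[p₂]) = φ₂ (θ g))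
  (α : absoluteGaloisGroup (baseFld p₁ φ₁ hφ₁) ≃ₜ* absoluteGaloisGroup (baseFld p₂ φ₂ hφ₂))
  (hα : ∀ τ : absoluteGaloisGroup (baseFld p₁ φ₁ hφ₁),
    ((galConjBase p₂ φ₂ hφ₂ (α τ) : ↥(baseFld p₂ φ₂ hφ₂).fixingSubgroup) : GalFbar ℚ_[p₂]) =
      (ψ ⟨(galConjBase p₁ φ₁ hφ₁ τ : ↥(baseFld p₁ φ₁ hφ₁).fixingSubgroup),
        MonoidHom.mem_range.mpr ((mem_fixingSubgroup_baseFld_iff p₁ φ₁ hφ₁ _).mp (galConjBase p₁ φ₁ hφ₁ τ).2)⟩ :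
          GalFbar ℚ_[p₂]))

include hψθ hα in
/-- `imEquiv θ` and `ψ` agree: both send `φ₁(x)` to `φ₂(θ x)`; read at `galConjBase₁ σ ∈ Im φ₁` and compared with `hα`,
`imEquiv θ (galConjBase₁ σ) = galConjBase₂ (α σ)`. [cite: MochizukiFrdII2008, Thm 2.4 (i) p.19] -/
theorem imEquiv_galConjBase_eq (σ : absoluteGaloisGroup (baseFld p₁ φ₁ hφ₁)) :
    imEquiv φ₁ hφ₁ φ₂ hφ₂ θ hkerθ hθc hθo hθs (galConjBase p₁ φ₁ hφ₁ σ) = galConjBase p₂ φ₂ hφ₂ (α σ) := by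
  obtain ⟨x, hx⟩ := MonoidHom.mem_range.mp
    (MonoidHom.mem_range.mpr ((mem_fixingSubgroup_baseFld_iff p₁ φ₁ hφ₁ _).mp (galConjBase p₁ φ₁ hφ₁ σ).2))
  apply Subtype.ext
  rw [coe_imEquiv_of_eq φ₁ hφ₁ φ₂ hφ₂ θ hkerθ hθc hθo hθs _ x hx, hα σ, ← hψθ x]
  congr 2
  exact Subtype.ext hx

include hψθ hα in
/-- **The two representatives of `G₁ ⥲ G₂` differ by the inner automorphism of `δ := galConjBase₂⁻¹(φ₂ c)`**, `c = baseRep` the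
representative singled out by the base identification `e` at `A₁`: `isoGOfTheta σ = δ⁻¹ · α σ · δ`.
[cite: MochizukiFrdII2008, Thm 2.4 (i) p.19] -/
theorem isoGOfTheta_eq_innerTwist (σ : absoluteGaloisGroup (baseFld p₁ φ₁ hφ₁)) :
    isoGOfTheta φ₁ hφ₁ φ₂ hφ₂ F θ hθc hθo hθs hkerθ e σ =
      ((galConjBase p₂ φ₂ hφ₂).symm (toIm φ₂ hφ₂ (baseRep F θ hθo e)))⁻¹ * α σ *
        (galConjBase p₂ φ₂ hφ₂).symm (toIm φ₂ hφ₂ (baseRep F θ hθo e)) := by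
  apply (galConjBase p₂ φ₂ hφ₂).injective
  rw [map_mul, map_mul, map_inv, ContinuousMulEquiv.apply_symm_apply, isoGOfTheta, ContinuousMulEquiv.trans_apply,
    ContinuousMulEquiv.trans_apply, ContinuousMulEquiv.trans_apply, ContinuousMulEquiv.apply_symm_apply,
    imEquiv_galConjBase_eq φ₁ hφ₁ φ₂ hφ₂ θ hθc hθo hθs hkerθ ψ hψθ α hα]
  rfl

include hψθ hα in
/-- The same in the `hα'` shape of `Prop121vii.IsAlphaEquivariant.innerTwist` (abc-iut-L1-t7 gen 7,
`AbsAnabUnitsTransportInnerTwist`): with `δ' := δ⁻¹ = galConjBase₂⁻¹(φ₂ c)⁻¹`, `isoGOfTheta σ = δ' · α σ · δ'⁻¹`.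
[cite: MochizukiFrdII2008, Thm 2.4 (i) p.19] -/
theorem isoGOfTheta_eq_innerTwist' (σ : absoluteGaloisGroup (baseFld p₁ φ₁ hφ₁)) :
    isoGOfTheta φ₁ hφ₁ φ₂ hφ₂ F θ hθc hθo hθs hkerθ e σ =
      ((galConjBase p₂ φ₂ hφ₂).symm (toIm φ₂ hφ₂ (baseRep F θ hθo e)))⁻¹ * α σ *
        (((galConjBase p₂ φ₂ hφ₂).symm (toIm φ₂ hφ₂ (baseRep F θ hθo e)))⁻¹)⁻¹ := by
  rw [inv_inv]
  exact isoGOfTheta_eq_innerTwist φ₁ hφ₁ φ₂ hφ₂ F θ hθc hθo hθs hkerθ e ψ hψθ α hα σ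

include hψθ hα in
/-- **Equivariance transfer**: if `ψ̄₀` is `α`-equivariant (abc-iut-w5-d229's `ψn`) then `δ⁻¹ • ψ̄₀` is equivariant for abc-iut-L1-t7's
representative `isoGOfTheta` (`Prop121vii.IsAlphaEquivariant.innerTwist` at `isoGOfTheta_eq_innerTwist'`).
[cite: MochizukiFrdII2008, Thm 2.4 (ii) p.21] -/
theorem isAlphaEquivariant_isoGOfTheta_innerTwist
    {ψ₀ : (AlgebraicClosure (baseFld p₁ φ₁ hφ₁))ˣ ≃* (AlgebraicClosure (baseFld p₂ φ₂ hφ₂))ˣ}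
    (h₀ : Prop121vii.IsAlphaEquivariant α ψ₀) :
    Prop121vii.IsAlphaEquivariant (isoGOfTheta φ₁ hφ₁ φ₂ hφ₂ F θ hθc hθo hθs hkerθ e)
      (ψ₀.trans (MulDistribMulAction.toMulEquiv ((AlgebraicClosure (baseFld p₂ φ₂ hφ₂))ˣ)
        (((galConjBase p₂ φ₂ hφ₂).symm (toIm φ₂ hφ₂ (baseRep F θ hθo e)))⁻¹))) :=
  h₀.innerTwist _ (isoGOfTheta_eq_innerTwist' φ₁ hφ₁ φ₂ hφ₂ F θ hθc hθo hθs hkerθ e ψ hψθ α hα)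

include hψθ hα in
/-- **THE units transports of the two representatives differ by `δ⁻¹`.**  For the `pᵢ`-adic MLF structures of the base fields
`Kᵢ = ℚ̄_{pᵢ}^{Im Πᵢ}` (`PadicAlgCl.subfieldValuativeRel`, abc-iut-L4): if `ψ̄₀` is `α`-equivariant and uniformiser-preserving
(abc-iut-w5-d229's `ψn`) and `ψ̄'` is `isoGOfTheta`-equivariant and uniformiser-preserving, then `ψ̄' x = δ⁻¹ • ψ̄₀ x` in `K̄₂`
(`Prop121vii.IsAlphaEquivariant.eq_innerTwist` at `isoGOfTheta_eq_innerTwist'`). [cite: MochizukiFrdII2008, Thm 2.4 (ii) p.21] -/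
theorem unitsTransport_isoGOfTheta_apply
    {ψ₀ ψ' : (AlgebraicClosure (baseFld p₁ φ₁ hφ₁))ˣ ≃* (AlgebraicClosure (baseFld p₂ φ₂ hφ₂))ˣ}
    (h₀ : Prop121vii.IsAlphaEquivariant α ψ₀)
    (hU₀ : letI := PadicAlgCl.subfieldValuativeRel (baseFld p₁ φ₁ hφ₁)
      letI := PadicAlgCl.subfieldValuativeRel (baseFld p₂ φ₂ hφ₂)
      haveI := finiteDimensional_baseFld p₁ φ₁ hφ₁; haveI := finiteDimensional_baseFld p₂ φ₂ hφ₂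
      haveI := PadicAlgCl.isNonarchimedeanLocalField_subfield (baseFld p₁ φ₁ hφ₁)
      haveI := PadicAlgCl.isNonarchimedeanLocalField_subfield (baseFld p₂ φ₂ hφ₂)
      Prop121vii.PreservesUniformizers ψ₀)
    (h' : Prop121vii.IsAlphaEquivariant
      (isoGOfTheta φ₁ hφ₁ φ₂ hφ₂ F θ hθc hθo hθs hkerθ e) ψ')
    (hU' : letI := PadicAlgCl.subfieldValuativeRel (baseFld p₁ φ₁ hφ₁)
      letI := PadicAlgCl.subfieldValuativeRel (baseFld p₂ φ₂ hφ₂)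
      haveI := finiteDimensional_baseFld p₁ φ₁ hφ₁; haveI := finiteDimensional_baseFld p₂ φ₂ hφ₂
      haveI := PadicAlgCl.isNonarchimedeanLocalField_subfield (baseFld p₁ φ₁ hφ₁)
      haveI := PadicAlgCl.isNonarchimedeanLocalField_subfield (baseFld p₂ φ₂ hφ₂)
      Prop121vii.PreservesUniformizers ψ')
    (x : (AlgebraicClosure (baseFld p₁ φ₁ hφ₁))ˣ) :
    ((ψ' x : (AlgebraicClosure (baseFld p₂ φ₂ hφ₂))ˣ) : AlgebraicClosure (baseFld p₂ φ₂ hφ₂)) =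
      ((galConjBase p₂ φ₂ hφ₂).symm (toIm φ₂ hφ₂ (baseRep F θ hθo e)))⁻¹ •
        ((ψ₀ x : (AlgebraicClosure (baseFld p₂ φ₂ hφ₂))ˣ) : AlgebraicClosure (baseFld p₂ φ₂ hφ₂)) := by
  letI := PadicAlgCl.subfieldValuativeRel (baseFld p₁ φ₁ hφ₁)
  letI := PadicAlgCl.subfieldValuativeRel (baseFld p₂ φ₂ hφ₂)
  haveI := finiteDimensional_baseFld p₁ φ₁ hφ₁; haveI := finiteDimensional_baseFld p₂ φ₂ hφ₂
  haveI := PadicAlgCl.isNonarchimedeanLocalField_subfield (baseFld p₁ φ₁ hφ₁)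
  haveI := PadicAlgCl.isNonarchimedeanLocalField_subfield (baseFld p₂ φ₂ hφ₂)
  haveI : CharZero (baseFld p₂ φ₂ hφ₂) :=
    charZero_of_injective_algebraMap (algebraMap ℚ_[p₂] (baseFld p₂ φ₂ hφ₂)).injective
  exact congrArg Units.val (Prop121vii.IsAlphaEquivariant.eq_innerTwist
    ((galConjBase p₂ φ₂ hφ₂).symm (toIm φ₂ hφ₂ (baseRep F θ hθo e)))⁻¹
    (isoGOfTheta_eq_innerTwist' φ₁ hφ₁ φ₂ hφ₂ F θ hθc hθo hθs hkerθ e ψ hψθ α hα) h₀ hU₀ h' hU' x)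

end RelGal

end PadicFrd

end Literature.AlgebraicGeometry.Frobenioids

end
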